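import Summits.KontsevichZagierPeriods.KontsevichZagierPeriods.Theorems.AbelContractionRealHyperellipticSectorPortSplitMoves

/-!
# Route AbelContraction — `RealHyperellipticSector` (crux stmt-KontsevichZagierPeriods-12475):
# the dimension-certified port, layer 2 — a simple real algebraic pole off `[0,1]` in normal form

Helper file of the line `Lines/birth.lean` (stub `stub_bakerAlg`, `--supports` the crux): the port
of `Theorems/HurwitzMicroSectorsNormalFormPrincipleSiegeNfAPoleOneK3.lean` (namespace
`…NormalFormPrinciple.PiBox.Dlog.SiegeK3`) INTO THE BUDGET `KZ.relationsLE 1` — every statement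
`… ∈ relations` / `… in FormalRep ⧸ relations` of that file re-proved with `relationsLE 1`, each
base move carrying the certificate that its representations have dimension `≤ 1`:

* the affine move with real ALGEBRAIC coefficients (`affineA_sub_mem_relationsLE`, rule 2 among
  representations of dimension `1`; this is also the budget form of
  `PiBox.AlgSplitK5.affineA_sub_mem_relations`, which has the same statement — the port of
  `…AlgSplitK5Kit.lean` reuses this one instead of re-declaring it);
* the two pole-carrier moves `pole_carrier_sub_mem_relationsLE_of_neg` (`ρ < 0`: chart
  `x = (−ρ) y + ρ`) and `pole_carrier_sub_mem_relationsLE_of_one_lt` (`1 < ρ`: chart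
  `x = (1−ρ) y + ρ`);
* `nfA_pole_one` (registered sub-goal): `[(0,1), c/(x−ρ)] ≡ [pt, 0] + [(1,u), c'/y]` in
  `FormalRep ⧸ relationsLE 1`, ONE carrier with `u > 1`, `u, c'` real algebraic.

The slab images are `image_affine_slab_of_pos/neg` of `…SplitMoves.lean` (dimension-free, reused);
`[pt, 0] ∈ relationsLE 1` is `Port.Dlog.pt_zero_mem_relationsLE`.

Sources: M. Kontsevich, D. Zagier, *Periods* (2001), §1.2 rules (1), (2) [KontsevichZagier2001].
No definitions are introduced.
-/

noncomputable section

open MeasureTheory Set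
open Literature.NumberTheory.Transcendental Literature.NumberTheory.Transcendental.KZ
open Literature.ModelTheory.ExponentialFields (IsSemialgebraic)

namespace Summit.KontsevichZagierPeriods.AbelContraction.RealHyperellipticSector.Port

namespace Dlog

namespace SiegeK3

open Summit.KontsevichZagierPeriods.KontsevichZagierPeriods.BetaCancellationLine
  (aff_hasFDerivAt_chart aff_injective_chart aff_isSemialgebraicMapOn_chart)
open Summit.KontsevichZagierPeriods.HurwitzMicroSectors.NormalFormPrinciple.PiBox.Dlog
  (image_affine_slab_of_pos image_affine_slab_of_neg)

/-! ## The affine move with real algebraic coefficients inside the budget -/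

/-- **Affine move with real algebraic coefficients** (rule 2 among representations of dimension
`1`), either orientation (inside the budget `relationsLE 1`): if `Φ(y) = s y + t` (`s ≠ 0`, `s, t`
real algebraic) maps `N.domain` onto `L.domain` and `N`'s integrand is the pull-back `f(Φ y)·|s|`
of `L`'s integrand `f`, then `[N] − [L] ∈ relationsLE 1`. [cite: KontsevichZagier2001, §1.2 rule (2)] -/
theorem affineA_sub_mem_relationsLE {s t : ℝ} (hsA : IsAlgebraic ℚ s) (htA : IsAlgebraic ℚ t)
    (hs : s ≠ 0) (N L : IntegralRep 1) (f : ℝ → ℝ)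
    (himage : L.domain = (fun y : Fin 1 → ℝ => fun _ : Fin 1 => s * y 0 + t) '' N.domain)
    (hLi : EqOn L.integrand (fun x => f (x 0)) L.domain)
    (hNi : EqOn N.integrand (fun x => f (s * x 0 + t) * |s|) N.domain) :
    of N - of L ∈ relationsLE 1 := by
  -- the Jacobian `|det (s • id_{ℝ¹})| = |s|` (as in `affine_sub_mem_relationsLE`)
  have hdet : |(s • ContinuousLinearMap.id ℝ (Fin 1 → ℝ)).det| = |s| := by
    have : (s • ContinuousLinearMap.id ℝ (Fin 1 → ℝ)).det = s := by
      change LinearMap.det ((s • ContinuousLinearMap.id ℝ (Fin 1 → ℝ) :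
        (Fin 1 → ℝ) →L[ℝ] (Fin 1 → ℝ)) : (Fin 1 → ℝ) →ₗ[ℝ] (Fin 1 → ℝ)) = s
      rw [ContinuousLinearMap.toLinearMap_smul, ContinuousLinearMap.coe_id,
        LinearMap.det_smul, LinearMap.det_id, Module.finrank_fin_fun]
      ring
    rw [this]
  refine Budget.changeOfVariables_mem_relationsLE le_rfl
    (fun y : Fin 1 → ℝ => fun _ : Fin 1 => s * y 0 + t)
    (fun _ => s • ContinuousLinearMap.id ℝ (Fin 1 → ℝ))
    (aff_isSemialgebraicMapOn_chart N.isSemialgebraic_domain htA hsA)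
    (fun x _ => (aff_hasFDerivAt_chart s t x).hasFDerivWithinAt)
    (aff_injective_chart hs t).injOn himage fun x hx => ?_
  have hΦx : (fun _ : Fin 1 => s * x 0 + t) ∈ L.domain := himage ▸ Set.mem_image_of_mem _ hx
  rw [hNi hx, hLi hΦx, hdet]

/-! ## The two pole-carrier moves inside the budget -/

/-- **Pole to the left** (`ρ < 0`): `[(1, 1 − ρ⁻¹), c/y] − [(0,1), c/(x − ρ)] ∈ relationsLE 1`, by
the increasing affine chart `x = (−ρ) y + ρ` (Jacobian `−ρ`) (inside the budget `relationsLE 1`).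
[cite: KontsevichZagier2001, §1.2 rule (2)] -/
theorem pole_carrier_sub_mem_relationsLE_of_neg {RA : ℝ → ℝ → ℝ → IntegralRep 1}
    (hR : ∀ a b c, IsAlgebraic ℚ a → IsAlgebraic ℚ b → IsAlgebraic ℚ c → 0 < a →
      (RA a b c).domain = {x | x 0 ∈ Set.Ioo a b} ∧ (RA a b c).integrand = fun x => c / x 0)
    {c ρ : ℝ} (hc : IsAlgebraic ℚ c) (hρA : IsAlgebraic ℚ ρ) (hρ0 : ρ < 0) (T : IntegralRep 1)
    (hTd : T.domain = {x | x 0 ∈ Set.Ioo (0:ℝ) 1})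
    (hTi : EqOn T.integrand (fun x => c / (x 0 - ρ)) T.domain) :
    of (RA 1 (1 - ρ⁻¹) c) - of T ∈ relationsLE 1 := by
  have huA : IsAlgebraic ℚ (1 - ρ⁻¹) := isAlgebraic_one.sub hρA.inv
  obtain ⟨hNd, hNi⟩ := hR 1 (1 - ρ⁻¹) c isAlgebraic_one huA hc one_pos
  have hs0 : 0 < -ρ := neg_pos.mpr hρ0
  have hρne : ρ ≠ 0 := hρ0.ne
  refine affineA_sub_mem_relationsLE hρA.neg hρA hs0.ne' (RA 1 (1 - ρ⁻¹) c) T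
    (fun x => c / (x - ρ)) ?_ (fun x hx => hTi hx) fun x _ => ?_
  · -- the chart maps `(1, 1 − ρ⁻¹)` onto `(0,1)`
    rw [hNd, image_affine_slab_of_pos hs0, hTd]
    have h1 : -ρ * 1 + ρ = 0 := by ring
    have h2 : -ρ * (1 - ρ⁻¹) + ρ = 1 := by field_simp; ring
    rw [h1, h2]
  · -- the pull-back identity `c/y = c/((−ρ) y + ρ − ρ)·|−ρ|` on `(1, 1 − ρ⁻¹)`
    rw [hNi, abs_of_pos hs0]
    show c / x 0 = c / (-ρ * x 0 + ρ - ρ) * -ρ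
    rw [show -ρ * x 0 + ρ - ρ = x 0 * -ρ by ring, div_mul_eq_mul_div,
      mul_div_mul_right _ _ hs0.ne']

/-- **Pole to the right** (`1 < ρ`): `[(1, ρ/(ρ−1)), (−c)/y] − [(0,1), c/(x − ρ)] ∈ relationsLE 1`,
by the decreasing affine chart `x = (1−ρ) y + ρ` (Jacobian `|1−ρ| = ρ − 1`) (inside the budget
`relationsLE 1`). [cite: KontsevichZagier2001, §1.2 rule (2)] -/
theorem pole_carrier_sub_mem_relationsLE_of_one_lt {RA : ℝ → ℝ → ℝ → IntegralRep 1}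
    (hR : ∀ a b c, IsAlgebraic ℚ a → IsAlgebraic ℚ b → IsAlgebraic ℚ c → 0 < a →
      (RA a b c).domain = {x | x 0 ∈ Set.Ioo a b} ∧ (RA a b c).integrand = fun x => c / x 0)
    {c ρ : ℝ} (hc : IsAlgebraic ℚ c) (hρA : IsAlgebraic ℚ ρ) (hρ1 : 1 < ρ) (T : IntegralRep 1)
    (hTd : T.domain = {x | x 0 ∈ Set.Ioo (0:ℝ) 1})
    (hTi : EqOn T.integrand (fun x => c / (x 0 - ρ)) T.domain) :
    of (RA 1 (ρ / (ρ - 1)) (-c)) - of T ∈ relationsLE 1 := by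
  have huA : IsAlgebraic ℚ (ρ / (ρ - 1)) := by
    rw [div_eq_mul_inv]
    exact hρA.mul (hρA.sub isAlgebraic_one).inv
  obtain ⟨hNd, hNi⟩ := hR 1 (ρ / (ρ - 1)) (-c) isAlgebraic_one huA hc.neg one_pos
  have hs0 : 1 - ρ < 0 := by linarith
  have hρ1' : 0 < ρ - 1 := by linarith
  refine affineA_sub_mem_relationsLE (isAlgebraic_one.sub hρA) hρA hs0.ne (RA 1 (ρ / (ρ - 1)) (-c))
    T (fun x => c / (x - ρ)) ?_ (fun x hx => hTi hx) fun x _ => ?_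
  · -- the chart maps `(1, ρ/(ρ−1))` onto `(0,1)` (reversing the orientation)
    rw [hNd, image_affine_slab_of_neg hs0, hTd]
    have h1 : (1 - ρ) * (ρ / (ρ - 1)) + ρ = 0 := by field_simp; ring
    have h2 : (1 - ρ) * 1 + ρ = 1 := by ring
    rw [h1, h2]
  · -- the pull-back identity `(−c)/y = c/((1−ρ) y + ρ − ρ)·|1−ρ|` on `(1, ρ/(ρ−1))`
    rw [hNi, abs_of_neg hs0]
    show -c / x 0 = c / ((1 - ρ) * x 0 + ρ - ρ) * -(1 - ρ)
    rw [show (1 - ρ) * x 0 + ρ - ρ = x 0 * (1 - ρ) by ring, div_mul_eq_mul_div,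
      show c * -(1 - ρ) = -c * (1 - ρ) by ring, mul_div_mul_right _ _ hs0.ne]

/-! ## The registered sub-goal inside the budget -/

/-- **`nfA_pole_one` inside the budget** (registered sub-goal of crux
stmt-KontsevichZagierPeriods-12475, port of `PiBox.Dlog.SiegeK3.nfA_pole_one`): a simple real
algebraic pole off `[0,1]` is in algebraic normal form — `[(0,1), c/(x−ρ)] ≡ [pt, 0] + [(1,u), c'/y]`
modulo `KZ.relationsLE 1`, with ONE carrier: `(u, c') = (1 − ρ⁻¹, c)` if `ρ < 0` and
`(u, c') = (ρ/(ρ−1), −c)` if `1 < ρ` (one affine move each among representations of dimension `1`,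
`pole_carrier_sub_mem_relationsLE_of_neg` / `…_of_one_lt`), `u > 1` and `u, c'` real algebraic;
`[pt, 0] ∈ relationsLE 1` (inside the budget `relationsLE 1`).
[cite: KontsevichZagier2001, §1.2 rules (1), (2)] -/
theorem nfA_pole_one : ∀ {RA : ℝ → ℝ → ℝ → KZ.IntegralRep 1} {ZA : ℝ → KZ.IntegralRep 0},
    (∀ a b c, IsAlgebraic ℚ a → IsAlgebraic ℚ b → IsAlgebraic ℚ c → 0 < a →
      (RA a b c).domain = {x | x 0 ∈ Set.Ioo a b} ∧ (RA a b c).integrand = fun x => c / x 0) →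
    (∀ r, IsAlgebraic ℚ r → (ZA r).domain = Set.univ ∧ (ZA r).integrand = fun _ => r) →
    ∀ {c ρ : ℝ}, IsAlgebraic ℚ c → IsAlgebraic ℚ ρ → ρ ∉ Set.Icc (0:ℝ) 1 →
    ∀ (T : KZ.IntegralRep 1), T.domain = {x | x 0 ∈ Set.Ioo (0:ℝ) 1} →
    Set.EqOn T.integrand (fun x => c / (x 0 - ρ)) T.domain →
    ∃ (r : ℝ) (k : ℕ) (u c : Fin k → ℝ), IsAlgebraic ℚ r ∧ (∀ j, 1 < u j) ∧
      (∀ j, IsAlgebraic ℚ (u j)) ∧ (∀ j, IsAlgebraic ℚ (c j)) ∧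
      QuotientAddGroup.mk' (KZ.relationsLE 1) (KZ.of T) =
        QuotientAddGroup.mk' (KZ.relationsLE 1) (KZ.of (ZA r)) +
          ∑ j, QuotientAddGroup.mk' (KZ.relationsLE 1) (KZ.of (RA 1 (u j) (c j))) := by
  intro RA ZA hR hZ c ρ hc hρA hρ T hTd hTi
  -- `ρ ∉ [0,1]`: the pole is to the left or to the right of the unit slab
  have hρ' : ρ < 0 ∨ 1 < ρ := by
    rcases lt_or_ge ρ 0 with h | h
    · exact Or.inl h
    · exact Or.inr (not_le.mp fun h1 => hρ ⟨h, h1⟩)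
  -- the point representation `[pt, 0]` is a truncated relation
  have hZ0 : of (ZA 0) ∈ relationsLE 1 := pt_zero_mem_relationsLE (ZA 0) (hZ 0 isAlgebraic_zero).2
  -- assembly in `FormalRep ⧸ relationsLE 1` from ONE carrier with `[RA 1 u c'] − [T] ∈ relationsLE 1`
  suffices key : ∃ u c' : ℝ, 1 < u ∧ IsAlgebraic ℚ u ∧ IsAlgebraic ℚ c' ∧
      of (RA 1 u c') - of T ∈ relationsLE 1 by
    obtain ⟨u, c', hu1, huA, hcA, hrel⟩ := key
    refine ⟨0, 1, fun _ => u, fun _ => c', isAlgebraic_zero, fun _ => hu1, fun _ => huA,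
      fun _ => hcA, ?_⟩
    simp only [QuotientAddGroup.mk'_apply, Fin.sum_univ_one]
    rw [(QuotientAddGroup.eq_zero_iff _).mpr hZ0, zero_add, eq_comm, QuotientAddGroup.eq_iff_sub_mem]
    exact hrel
  rcases hρ' with hρ0 | hρ1
  · refine ⟨1 - ρ⁻¹, c, ?_, isAlgebraic_one.sub hρA.inv, hc,
      pole_carrier_sub_mem_relationsLE_of_neg hR hc hρA hρ0 T hTd hTi⟩
    have : ρ⁻¹ < 0 := inv_lt_zero.mpr hρ0
    linarith
  · refine ⟨ρ / (ρ - 1), -c, ?_, ?_, hc.neg,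
      pole_carrier_sub_mem_relationsLE_of_one_lt hR hc hρA hρ1 T hTd hTi⟩
    · rw [one_lt_div (by linarith : (0:ℝ) < ρ - 1)]
      linarith
    · rw [div_eq_mul_inv]
      exact hρA.mul (hρA.sub isAlgebraic_one).inv

end SiegeK3

end Dlog

end Summit.KontsevichZagierPeriods.AbelContraction.RealHyperellipticSector.Port

end
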